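import Summits.BirchSwinnertonDyer.BirchSwinnertonDyer.Theorems.KolyvaginDepthDoorRingClassTowerRigidity
import HarnessLib

/-!
# Route `KolyvaginDepthDoor`, crux `KolyvaginDepthSupply` (stmt-BirchSwinnertonDyer-21765) —
# THE COMPATIBLE SYSTEM OF KOLYVAGIN–HEEGNER DATA ON ALL SQUARE-FREE INERT LEVELS, PART 2:
# transversals — restriction of a transversal, and the fibre-product transversal over the prime levels

Helper file (`--supports stmt-BirchSwinnertonDyer-21765 --as helper`); it closes nothing and BSD is
not proved by it.

Sequel of `…RingClassTowerRigidity` (PART 1: `G_q(n) → G_q(q)` is a bijection; separation). For `K`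
imaginary quadratic with `d_K < −4` and `n` square-free with inert prime factors:

* `existsUnique_restrict_transversal` — the restriction to `K[q]` (`q ∣ n`) of a transversal of
  `G_n = Gal(K[n]/K[1])` in `𝒢_n = Gal(K[n]/K)` is a transversal of `Gal(K[q]/K[1])` in `𝒢_q`;
* `existsUnique_transversal_of_prime_transversals` — **the fibre-product transversal**: given a
  transversal `S₀ q` of `Gal(K[q]/K[1])` in `𝒢_q` for every prime `q ∣ n`, the elements of `𝒢_n` whose
  restrictions to every `K[q]` lie in `S₀ q` form a transversal of `G_n` in `𝒢_n` — so transversals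
  chosen ONCE at the prime levels determine transversals at every level, coherently (the defining
  condition is stable under restriction `K[m] ⊆ K[n]`);
* `zpowers_restrict_eq_ringClassGalOver_one` — a generator of `G_q(n)` restricts to a generator of
  `G_q(q)` (the prime-level generator read off a given datum).

All statements quantify over ANY restriction homomorphisms with the value formula (X11b's
convention, `RingClassTowerRestriction`); THEOREMS ONLY (no definition, no named fact, no `sorry`),
unconditional. Used by PART 3 (`…KolyvaginHeegnerSystem`) to build McCallum's "one system of
choices" over all levels at once.

References: [GrossLMS1991] B. H. Gross, *Kolyvagin's work on modular elliptic curves*, LMS LNS 153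
(1991), §3 (p. 239: "`G_n ≃ ∏ G_ℓ`"), §4 ((4.1): "Let `S` be a set of coset representatives for `G_n`
in `𝒢_n`"); [McCallumLMS1991] §4.
-/

set_option linter.dupNamespace false

noncomputable section

open scoped Classical
open Field NumberField Module
open Literature.NumberTheory.EllipticCurves Literature.NumberTheory.EllipticCurves.RingClassField
open Literature.NumberTheory.QuadraticFields Literature.NumberTheory.QuadraticFields.RingClass
open Summit.BirchSwinnertonDyer.Rank1Residual.X11b.RingClassTower

namespace Summit.BirchSwinnertonDyer.BirchSwinnertonDyer.Theorems.KolyvaginDepthDoor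

variable {K : Type} [Field K] [NumberField K]

/-! ## §4 Transversals: restriction, and the fibre product over the prime levels -/

/-- **The restriction of a transversal is a transversal**: for `q ∣ n` (`n ≥ 1`), any restriction
homomorphism `res : 𝒢_n → Aut_ℚ(K[q])` (value formula) and a set `S ⊆ 𝒢_n` of coset representatives
of `G_n = Gal(K[n]/K[1])` in `𝒢_n`, the image `res(S)` is a set of coset representatives of
`Gal(K[q]/K[1])` in `𝒢_q` (both of index `[K[1] : K]`; Gross 1991, §4: the exact sequence
`0 → G_n → 𝒢_n → Gal(K_1/K) → 0` at the two levels). [cite: GrossLMS1991, §4 ((4.1), 𝒢_n/G_n)] -/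
theorem existsUnique_restrict_transversal (hK : IsImaginaryQuadratic K) (ι : K →+* ℂ) {q n : ℕ}
    (hqn : q ∣ n) (hn : n ≠ 0)
    {res : ringClassGal ι n →* (ringClassField K ι q ≃ₐ[ℚ] ringClassField K ι q)}
    (hres : ∀ (g : ringClassGal ι n) (x : ringClassField K ι q) (y : ringClassField K ι n),
      (x : ℂ) = (y : ℂ) → ((res g x : ringClassField K ι q) : ℂ) =
        (((g : ringClassField K ι n ≃ₐ[ℚ] ringClassField K ι n) y : ringClassField K ι n) : ℂ))
    {S : Finset (ringClassField K ι n ≃ₐ[ℚ] ringClassField K ι n)}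
    (hS : ∀ s ∈ S, s ∈ ringClassGal ι n)
    (hT : ∀ g ∈ ringClassGal ι n, ∃! s, s ∈ S ∧ g⁻¹ * s ∈ ringClassGalOver ι n 1)
    {h : ringClassField K ι q ≃ₐ[ℚ] ringClassField K ι q} (hh : h ∈ ringClassGal ι q) :
    ∃! s', (∃ (s : _) (hs : s ∈ S), res ⟨s, hS s hs⟩ = s') ∧ h⁻¹ * s' ∈ ringClassGalOver ι q 1 := by
  have hq0 : q ≠ 0 := fun h0 => hn (Nat.eq_zero_of_zero_dvd (h0 ▸ hqn))
  have h1q : ringClassField K ι 1 ≤ ringClassField K ι q := ringClassField_mono hK ι (one_dvd q) hq0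
  -- lift `h` to `g ∈ 𝒢_n` and take its representative
  obtain ⟨g, hg⟩ := exists_restrictHom_eq hK ι hqn hn hres hh
  obtain ⟨s, ⟨hsS, hgs⟩, huniq⟩ := hT (g : ringClassField K ι n ≃ₐ[ℚ] ringClassField K ι n) g.2
  have hgs' : ((g⁻¹ * ⟨s, hS s hsS⟩ : ringClassGal ι n) : ringClassField K ι n ≃ₐ[ℚ]
      ringClassField K ι n) ∈ ringClassGalOver ι n 1 := hgs
  have hrep : h⁻¹ * res ⟨s, hS s hsS⟩ ∈ ringClassGalOver ι q 1 := by
    rw [← hg, ← map_inv, ← map_mul]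
    exact restrictHom_mem_ringClassGalOver hK ι hqn hn hres _ hgs'
  refine ⟨res ⟨s, hS s hsS⟩, ⟨⟨s, hsS, rfl⟩, hrep⟩, ?_⟩
  rintro s' ⟨⟨t, htS, rfl⟩, hts'⟩
  -- `res (s⁻¹ t) ∈ Gal(K[q]/K[1])`, hence `s⁻¹ t ∈ G_n`, hence `t = s`
  have hmem : res ((⟨s, hS s hsS⟩ : ringClassGal ι n)⁻¹ * ⟨t, hS t htS⟩) ∈ ringClassGalOver ι q 1 := by
    have h3 := (ringClassGalOver ι q 1).mul_mem ((ringClassGalOver ι q 1).inv_mem hrep) hts'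
    rwa [mul_inv_rev, inv_inv, mul_assoc, mul_inv_cancel_left, ← map_inv, ← map_mul] at h3
  have hGn := mem_ringClassGalOver_of_restrictHom_mem ι hres h1q _ hmem
  have hst : s⁻¹ * t ∈ ringClassGalOver ι n 1 := hGn
  have hgt : (g : ringClassField K ι n ≃ₐ[ℚ] ringClassField K ι n)⁻¹ * t ∈ ringClassGalOver ι n 1 := by
    have h4 := (ringClassGalOver ι n 1).mul_mem hgs hst
    rwa [mul_assoc, mul_inv_cancel_left] at h4
  have ht : t = s := huniq t ⟨htS, hgt⟩
  subst ht
  rfl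

/-- For distinct primes `q, a ∣ n`: `q ∣ n / a`. [folklore] -/
theorem dvd_div_of_mem_primeFactors_of_ne {q a n : ℕ} (hq : q ∈ n.primeFactors)
    (ha : a ∈ n.primeFactors) (hne : q ≠ a) : q ∣ n / a := by
  obtain ⟨hqp, hqn, -⟩ := Nat.mem_primeFactors.mp hq
  obtain ⟨hap, han, -⟩ := Nat.mem_primeFactors.mp ha
  have hcop : Nat.Coprime q a := (Nat.coprime_primes hqp hap).mpr hne
  have h : q ∣ a * (n / a) := by rwa [Nat.mul_div_cancel' han]
  exact hcop.dvd_of_dvd_mul_left h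

/-- **The fibre-product transversal** (Gross 1991, §3–§4: "`G_n ≃ ∏ G_ℓ`", "Let `S` be a set of
coset representatives for `G_n` in `𝒢_n`"): for `K` imaginary quadratic with `d_K < −4`, `n`
square-free with inert prime factors, restriction homomorphisms `R q : 𝒢_n → Aut_ℚ(K[q])` (value
formula) and, for every prime `q ∣ n`, a transversal `S₀ q` of `Gal(K[q]/K[1])` in `𝒢_q`, the
elements `s ∈ 𝒢_n` with `R q s ∈ S₀ q` for all `q ∣ n` form a transversal of `G_n = Gal(K[n]/K[1])`
in `𝒢_n`. Existence: correct `h` by the product of the unique lifts (to `G_q(n)`) of the defects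
`(R q h)⁻¹ s_q ∈ G_q(q)`; uniqueness: separation (`eq_one_of_forall_restrict_prime_eq_one`).
[cite: GrossLMS1991, §3 (p. 239, G_n ≃ ∏ G_ℓ), §4 ((4.1), S)] -/
theorem existsUnique_transversal_of_prime_transversals (hK : IsImaginaryQuadratic K) (ι : K →+* ℂ)
    (hd4 : NumberField.discr K < -4) {n : ℕ} (hsq : Squarefree n)
    (hinert : ∀ p ∈ n.primeFactors, (Ideal.span {(p : 𝓞 K)}).IsPrime)
    (R : ∀ q : ℕ, ringClassGal ι n →* (ringClassField K ι q ≃ₐ[ℚ] ringClassField K ι q))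
    (hR : ∀ q ∈ n.primeFactors, ∀ (g : ringClassGal ι n) (x : ringClassField K ι q)
      (y : ringClassField K ι n), (x : ℂ) = (y : ℂ) → ((R q g x : ringClassField K ι q) : ℂ) =
        (((g : ringClassField K ι n ≃ₐ[ℚ] ringClassField K ι n) y : ringClassField K ι n) : ℂ))
    (S₀ : ∀ q : ℕ, Finset (ringClassField K ι q ≃ₐ[ℚ] ringClassField K ι q))
    (hT₀ : ∀ q ∈ n.primeFactors, ∀ h ∈ ringClassGal ι q,
      ∃! s, s ∈ S₀ q ∧ h⁻¹ * s ∈ ringClassGalOver ι q 1)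
    {h : ringClassField K ι n ≃ₐ[ℚ] ringClassField K ι n} (hh : h ∈ ringClassGal ι n) :
    ∃! s : ringClassField K ι n ≃ₐ[ℚ] ringClassField K ι n,
      (∃ hs : s ∈ ringClassGal ι n, ∀ q ∈ n.primeFactors, R q ⟨s, hs⟩ ∈ S₀ q) ∧
        h⁻¹ * s ∈ ringClassGalOver ι n 1 := by
  have hn : n ≠ 0 := Squarefree.ne_zero hsq
  set h' : ringClassGal ι n := ⟨h, hh⟩ with hh'_def
  -- the representatives `s_q` of the restrictions `R q h'` and the defects `u_q = (R q h')⁻¹ s_q`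
  have hrep : ∀ q ∈ n.primeFactors, ∃ sq, sq ∈ S₀ q ∧ (R q h')⁻¹ * sq ∈ ringClassGalOver ι q 1 :=
    fun q hq => (hT₀ q hq (R q h') (restrictHom_mem_ringClassGal ι (hR q hq) h')).exists
  choose! sq hsq₀ hsq₁ using hrep
  -- the unique lifts `ũ_q ∈ G_q(n)` of the defects
  have hlift : ∀ q ∈ n.primeFactors, ∃ u : ringClassGal ι n,
      (u : ringClassField K ι n ≃ₐ[ℚ] ringClassField K ι n) ∈ ringClassGalOver ι n (n / q) ∧
        R q u = (R q h')⁻¹ * sq q := fun q hq =>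
    (existsUnique_lift_ringClassGalOver_prime hK ι hd4 hsq hinert hq (hR q hq) (hsq₁ q hq)).exists
  choose! U hU₀ hU₁ using hlift
  set L := n.primeFactorsList with hL_def
  have hLmem : ∀ a, a ∈ L ↔ a ∈ n.primeFactors := fun a => by
    rw [hL_def, ← Nat.toFinset_factors, List.mem_toFinset]
  set P : ringClassGal ι n := (L.map U).prod with hP_def
  -- `P ∈ G_n`
  have hPmem : (P : ringClassField K ι n ≃ₐ[ℚ] ringClassField K ι n) ∈ ringClassGalOver ι n 1 := by
    have hH : P ∈ (ringClassGalOver ι n 1).subgroupOf (ringClassGal ι n) := by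
      refine Subgroup.list_prod_mem _ fun x hx => ?_
      obtain ⟨a, ha, rfl⟩ := List.mem_map.mp hx
      have ha' : a ∈ n.primeFactors := (hLmem a).mp ha
      rw [Subgroup.mem_subgroupOf]
      exact ringClassGalOver_le_of_le ι n
        (ringClassField_mono hK ι (one_dvd _) (div_ne_zero_of_mem_primeFactors ha')) (hU₀ a ha')
    exact (Subgroup.mem_subgroupOf).mp hH
  -- the restrictions of `P`: `R q P = u_q`
  have hPres : ∀ q ∈ n.primeFactors, R q P = (R q h')⁻¹ * sq q := by
    intro q hq
    obtain ⟨hqp, hqn, -⟩ := Nat.mem_primeFactors.mp hq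
    rw [hP_def, map_list_prod, List.map_map]
    have hsingle := List.prod_map_eq_pow_single (l := L) q (fun a => R q (U a)) (fun a hne ha => by
      have ha' : a ∈ n.primeFactors := (hLmem a).mp ha
      have hqa : ringClassField K ι q ≤ ringClassField K ι (n / a) :=
        ringClassField_mono hK ι (dvd_div_of_mem_primeFactors_of_ne hq ha' hne.symm)
          (div_ne_zero_of_mem_primeFactors ha')
      exact restrictHom_eq_one_of_mem hK ι hqn hn (hR q hq) (U a)
        (ringClassGalOver_le_of_le ι n hqa (hU₀ a ha')))
    have hcount : L.count q = 1 :=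
      List.count_eq_one_of_mem hsq.nodup_primeFactorsList ((hLmem q).mpr hq)
    rw [Function.comp_def, hsingle, hcount, pow_one, hU₁ q hq]
  -- the candidate `s = h · P`
  refine ⟨((h' * P : ringClassGal ι n) : ringClassField K ι n ≃ₐ[ℚ] ringClassField K ι n),
    ⟨⟨(h' * P).2, fun q hq => ?_⟩, ?_⟩, ?_⟩
  · have : (⟨((h' * P : ringClassGal ι n) : ringClassField K ι n ≃ₐ[ℚ] ringClassField K ι n),
        (h' * P).2⟩ : ringClassGal ι n) = h' * P := rfl
    rw [this, map_mul, hPres q hq, mul_inv_cancel_left]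
    exact hsq₀ q hq
  · change h⁻¹ * (h * (P : ringClassField K ι n ≃ₐ[ℚ] ringClassField K ι n)) ∈ _
    rwa [inv_mul_cancel_left]
  -- uniqueness
  rintro s ⟨⟨hs, hsq'⟩, hhs⟩
  have hPs : h⁻¹ * (h * (P : ringClassField K ι n ≃ₐ[ℚ] ringClassField K ι n)) ∈
      ringClassGalOver ι n 1 := by rwa [inv_mul_cancel_left]
  set t : ringClassGal ι n := (h' * P)⁻¹ * ⟨s, hs⟩ with ht_def
  have ht1 : (t : ringClassField K ι n ≃ₐ[ℚ] ringClassField K ι n) ∈ ringClassGalOver ι n 1 := by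
    have h3 := (ringClassGalOver ι n 1).mul_mem ((ringClassGalOver ι n 1).inv_mem hPs) hhs
    rw [mul_inv_rev, inv_inv, mul_assoc, mul_inv_cancel_left] at h3
    exact h3
  have htq : ∀ q ∈ n.primeFactors, R q t = 1 := by
    intro q hq
    have hRs : R q (h' * P) ∈ ringClassGal ι q := restrictHom_mem_ringClassGal ι (hR q hq) _
    obtain ⟨x, -, huniq⟩ := hT₀ q hq (R q (h' * P)) hRs
    have e1 : R q (h' * P) = x := huniq _ ⟨by
      rw [map_mul, hPres q hq, mul_inv_cancel_left]; exact hsq₀ q hq, by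
      rw [inv_mul_cancel]; exact Subgroup.one_mem _⟩
    have e2 : R q ⟨s, hs⟩ = x := huniq _ ⟨hsq' q hq, by
      rw [← map_inv, ← map_mul]
      exact restrictHom_mem_ringClassGalOver hK ι (Nat.dvd_of_mem_primeFactors hq) hn (hR q hq) t ht1⟩
    rw [ht_def, map_mul, map_inv, e1, e2, inv_mul_cancel]
  have ht : t = 1 := eq_one_of_forall_restrict_prime_eq_one hK ι hd4 hsq hinert R hR ht1 htq
  have : (⟨s, hs⟩ : ringClassGal ι n) = h' * P := by
    rw [ht_def, inv_mul_eq_one] at ht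
    exact ht.symm
  exact congrArg Subtype.val this

/-! ## §5 A generator of `G_q(n)` restricts to a generator of `G_q(q)` -/

/-- **A generator `σ_q` of `G_q(n) = Gal(K[n]/K[n/q])` restricts to a generator of
`G_q(q) = Gal(K[q]/K[1])`** (`K` quadratic, `n` square-free, `q ∣ n` prime; onto half of
`existsUnique_lift_ringClassGalOver_prime`, no hypothesis on `d_K`). [cite: GrossLMS1991, §3 (p. 239)] -/
theorem zpowers_restrict_eq_ringClassGalOver_one (hK : IsImaginaryQuadratic K) (ι : K →+* ℂ)
    {q n : ℕ} (hsq : Squarefree n) (hq : q ∈ n.primeFactors)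
    {res : ringClassGal ι n →* (ringClassField K ι q ≃ₐ[ℚ] ringClassField K ι q)}
    (hres : ∀ (g : ringClassGal ι n) (x : ringClassField K ι q) (y : ringClassField K ι n),
      (x : ℂ) = (y : ℂ) → ((res g x : ringClassField K ι q) : ℂ) =
        (((g : ringClassField K ι n ≃ₐ[ℚ] ringClassField K ι n) y : ringClassField K ι n) : ℂ))
    {σ : ringClassField K ι n ≃ₐ[ℚ] ringClassField K ι n} (hσG : σ ∈ ringClassGal ι n)
    (hσ : Subgroup.zpowers σ = ringClassGalOver ι n (n / q)) :
    Subgroup.zpowers (res ⟨σ, hσG⟩) = ringClassGalOver ι q 1 := by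
  obtain ⟨hqp, hqn, hn⟩ := Nat.mem_primeFactors.mp hq
  have hqq : q / q = 1 := Nat.div_self hqp.pos
  have h1 : ringClassField K ι 1 ≤ ringClassField K ι (n / q) :=
    ringClassField_mono hK ι (one_dvd _) (div_ne_zero_of_mem_primeFactors hq)
  refine le_antisymm ((Subgroup.zpowers_le).mpr ?_) fun h hh => ?_
  · exact ringClassGalOver_le_of_le ι q h1 (restrictHom_mem_ringClassGalOver hK ι hqn hn hres ⟨σ, hσG⟩
      (by rw [← hσ]; exact Subgroup.mem_zpowers σ))
  · have hG1 := exists_mul_eq_of_restrict_div_eq_one (K := K) hK.1 hsq (dvd_refl q) hqn hqp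
    have hh' : h ∈ ringClassGalOver ι q (q / q) := by rw [hqq]; exact hh
    obtain ⟨g, hg, hgh⟩ :=
      exists_mem_ringClassGalOver_div_restrictHom_eq hK ι hqn hn hres (dvd_refl q) hG1 hh'
    rw [← hσ, Subgroup.mem_zpowers_iff] at hg
    obtain ⟨k, hk⟩ := hg
    have hgk : g = (⟨σ, hσG⟩ : ringClassGal ι n) ^ k :=
      Subtype.ext (by rw [SubgroupClass.coe_zpow]; exact hk.symm)
    rw [← hgh, hgk, map_zpow]
    exact Subgroup.zpow_mem_zpowers _ _


end Summit.BirchSwinnertonDyer.BirchSwinnertonDyer.Theorems.KolyvaginDepthDoor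

end
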